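import Literature.RepresentationTheory.CompactGroups.WeylIntegrationVandermonde
import Literature.Analysis.FunctionSpaces.BesselIGeneratingFunction
import HarnessLib

/-!
# Andréief's identity and the weighted Vandermonde integral `∫_{(−π,π]^N} Π_b e^{x cos θ_b} |Δ|² dθ = (2π)^N N! det[I_{|i−j|}(x)]`

HONEST FRAMING: exact (Metropolis-corrected) sampling algorithms for lattice gauge theory;
figures of merit are autocorrelation/cost numbers at stated couplings and volumes; no
continuum-physics claim.

Venture `LatticeQCDFlow` (cell pub-lqcd), sub-topic `Scoring`; FANOUT row 5 (`s0-sun-a`), GEN-17.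
NEW WORK of the cell (placement rule).  Part 1 of the `U(N)` one-plaquette law for EVERY `N` (part 2,
`UNOnePlaquetteBesselDeterminant.lean`, moves it to the Haar measure of `U(N)` with the tree's Weyl integral
formula): the eigen-angle side.

* §1 the finite (Andréief / Heine) identity behind every "determinant of one-variable integrals" formula:
  `Σ_σ Σ_τ sgn σ sgn τ Π_b A(σ⁻¹b, τ⁻¹b) = N! · det A` (any commutative ring, any finite index type);
* §2 the Fourier coefficients of the one-angle weight on a full period,
  `∫_{(−π,π]} e^{x cos θ} e^{imθ} dθ = 2π I_{|m|}(x)` (`m ∈ ℤ`; from the generating function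
  `e^{x cos θ} = Σ_m I_{|m|}(x) e^{imθ}` of `Literature/Analysis/FunctionSpaces/BesselIGeneratingFunction`);
* §3 **the weighted Vandermonde integral**: with `|Δ(θ)|² = Π_{j≺k}|e^{iθ_j} − e^{iθ_k}|²` (the tree's
  `WeylIntegration.vdm`, whose unweighted integral `(2π)^N N!` normalises Weyl's formula),
  `∫_{(−π,π]^N} (Π_b e^{x cos θ_b}) |Δ(θ)|² dθ = (2π)^N · N! · det[I_{|i−j|}(x)]_{i,j}`
  in complex and in real form (Leibniz double expansion `WeylIntegration.norm_vdm_sq_eq_sum`, Fubini on the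
  cube, §2, §1), whence `det[I_{|i−j|}(x)] ≥ 0`.

The determinant is indexed by `n` through the tree's fixed enumeration `enum n : n ≃ Fin |n|`; part 2
reindexes it to `Fin N`.  Published forms: the `U(N)` one-plaquette integral of I. Bars, F. Green,
Phys. Rev. D 20 (1979) 3311, (1.4)–(1.6); C. Andréief, Mém. Soc. Sci. Bordeaux 2 (1883) 1; the Heine–Szegő
identity for Toeplitz determinants.  No `def`, nothing cited as a fact, 0 sorry.
-/

noncomputable section

open Real MeasureTheory Finset Complex Equiv
open scoped ENNReal
open Literature.Analysis.FunctionSpaces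
open Literature.RepresentationTheory.CompactGroups.WeylIntegration

namespace Summit.Ventures.LatticeQCDFlow.Scoring

variable {n : Type*} [Fintype n] [DecidableEq n]

/-! ### 1. The Andréief–Heine identity: a double Leibniz sum is `N!` times a determinant -/

/-- **`Σ_σ Σ_τ sgn σ · sgn τ · Π_b A(σ⁻¹ b, τ⁻¹ b) = N! · det A`** (the finite identity behind Andréief's /
Heine's "determinant of single integrals" formulae): substitute `b = τ c`, then `σ ↦ σ⁻¹τ` is a bijection of
the symmetric group for each fixed `τ`, and what remains is the Leibniz expansion of `det A`, `N!` times. -/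
theorem sum_sum_sign_mul_sign_mul_prod_eq_factorial_mul_det {R : Type*} [CommRing R] (A : Matrix n n R) :
    ∑ σ : Perm n, ∑ τ : Perm n,
        ((Equiv.Perm.sign σ : ℤ) : R) * ((Equiv.Perm.sign τ : ℤ) : R) * ∏ b, A (σ.symm b) (τ.symm b)
      = (Fintype.card n).factorial * A.det := by
  classical
  rw [Finset.sum_comm]
  have hτ : ∀ τ : Perm n, ∑ σ : Perm n,
      ((Equiv.Perm.sign σ : ℤ) : R) * ((Equiv.Perm.sign τ : ℤ) : R) * ∏ b, A (σ.symm b) (τ.symm b)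
        = A.det := by
    intro τ
    -- substitute `b = τ c` in the product
    have hprod : ∀ σ : Perm n, ∏ b, A (σ.symm b) (τ.symm b) = ∏ c, A ((σ⁻¹ * τ) c) c := by
      intro σ
      rw [← Equiv.prod_comp τ (fun b => A (σ.symm b) (τ.symm b))]
      refine Finset.prod_congr rfl fun c _ => ?_
      simp [Equiv.Perm.mul_apply, Equiv.Perm.inv_def]
    simp_rw [hprod]
    -- the signs combine to `sgn(σ⁻¹ τ)`
    have hsign : ∀ σ : Perm n, ((Equiv.Perm.sign σ : ℤ) : R) * ((Equiv.Perm.sign τ : ℤ) : R)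
        = ((Equiv.Perm.sign (σ⁻¹ * τ) : ℤ) : R) := by
      intro σ
      rw [map_mul, map_inv, Int.units_inv_eq_self, Units.val_mul, Int.cast_mul]
    simp_rw [hsign]
    -- reindex `σ ↦ σ⁻¹ τ`
    rw [show ∑ σ : Perm n, ((Equiv.Perm.sign (σ⁻¹ * τ) : ℤ) : R) * ∏ c, A ((σ⁻¹ * τ) c) c
        = ∑ ρ : Perm n, ((Equiv.Perm.sign ρ : ℤ) : R) * ∏ c, A (ρ c) c from
      Equiv.sum_comp ((Equiv.inv (Perm n)).trans (Equiv.mulRight τ))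
        (fun ρ : Perm n => ((Equiv.Perm.sign ρ : ℤ) : R) * ∏ c, A (ρ c) c)]
    rw [Matrix.det_apply']
  simp_rw [hτ]
  rw [Finset.sum_const, Finset.card_univ, Fintype.card_perm, nsmul_eq_mul]

/-! ### 2. The Fourier coefficients of `e^{x cos θ}` over a full period -/

/-- **`∫_{(−π,π]} e^{x cos θ} e^{imθ} dθ = 2π I_{|m|}(x)`** for every integer `m` and real `x`: integrate the
absolutely convergent generating function `e^{x cos θ} = Σ_{k∈ℤ} I_{|k|}(x) e^{ikθ}` term by term against
`e^{imθ}`; only `k = −m` survives. -/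
theorem integral_Ioc_cexp_mul_cos_mul_cexp_int (x : ℝ) (m : ℤ) :
    ∫ θ in Set.Ioc (-π) π, cexp ((x : ℂ) * Real.cos θ) * cexp ((m : ℂ) * θ * I)
      = 2 * π * (besselI m.natAbs x : ℂ) := by
  -- the terms of the series, multiplied by `e^{imθ}`
  set F : ℤ → ℝ → ℂ := fun k θ => (besselI k.natAbs x : ℂ) * cexp (((k + m : ℤ) : ℂ) * θ * I) with hF
  have hFeq : ∀ θ : ℝ, cexp ((x : ℂ) * Real.cos θ) * cexp ((m : ℂ) * θ * I) = ∑' k, F k θ := by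
    intro θ
    rw [← (hasSum_besselI_natAbs_mul_cexp x θ).tsum_eq, ← tsum_mul_right]
    refine tsum_congr fun k => ?_
    simp only [hF]
    rw [mul_assoc, ← Complex.exp_add]
    congr 2
    push_cast
    ring
  have hFnorm : ∀ k θ, ‖F k θ‖ = besselI k.natAbs |x| := by
    intro k θ
    simp only [hF]
    rw [norm_mul, show (((k + m : ℤ) : ℂ)) * (θ : ℂ) * I = ((((k + m : ℤ) : ℝ) * θ : ℝ) : ℂ) * I by
      push_cast; ring, Complex.norm_exp_ofReal_mul_I, mul_one, Complex.norm_real, Real.norm_eq_abs,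
      abs_besselI_eq_besselI_abs]
  have hFint : ∀ k, Integrable (F k) (volume.restrict (Set.Ioc (-π) π)) := by
    intro k
    refine Integrable.mono' (integrable_const (besselI k.natAbs |x|)) ?_
      (Filter.Eventually.of_forall fun θ => (hFnorm k θ).le)
    exact (Continuous.aestronglyMeasurable (by simp only [hF]; fun_prop))
  have hFsum : Summable fun k => ∫ θ in Set.Ioc (-π) π, ‖F k θ‖ := by
    simp_rw [hFnorm, MeasureTheory.setIntegral_const]
    exact (summable_besselI_natAbs |x|).mul_left _
  calc ∫ θ in Set.Ioc (-π) π, cexp ((x : ℂ) * Real.cos θ) * cexp ((m : ℂ) * θ * I)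
      = ∫ θ in Set.Ioc (-π) π, ∑' k, F k θ := setIntegral_congr_fun measurableSet_Ioc fun θ _ => hFeq θ
    _ = ∑' k, ∫ θ in Set.Ioc (-π) π, F k θ := (integral_tsum_of_summable_integral_norm hFint hFsum).symm
    _ = ∑' k : ℤ, (besselI k.natAbs x : ℂ) * (if k + m = 0 then (2 * π : ℂ) else 0) := by
        refine tsum_congr fun k => ?_
        simp only [hF]
        rw [integral_const_mul, integral_Ioc_cexp_int_mul]
    _ = (besselI (-m).natAbs x : ℂ) * (2 * π) := by
        rw [tsum_eq_single (-m)]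
        · simp
        · intro k hk
          rw [if_neg (fun h => hk (by omega)), mul_zero]
    _ = 2 * π * (besselI m.natAbs x : ℂ) := by rw [Int.natAbs_neg, mul_comm]

/-! ### 3. The angle integral: `∫_{(−π,π]^N} Π_b e^{x cos θ_b} · |Δ|² dθ = (2π)^N N! det[I_{|i−j|}(x)]` -/

/-- Each term of the Leibniz double expansion, weighted by `Π_b e^{x cos θ_b}`, is integrable on the cube. -/
theorem integrable_cube_weighted_term (x : ℝ) (σ τ : Perm n) :
    Integrable (fun θ : n → ℝ => ((Equiv.Perm.sign σ : ℤ) : ℂ) * ((Equiv.Perm.sign τ : ℤ) : ℂ) *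
        ∏ b, (cexp ((x : ℂ) * Real.cos (θ b)) * cexp ((charVec σ b - charVec τ b : ℤ) * θ b * I)))
      (Measure.pi fun _ : n => (volume : Measure ℝ).restrict (Set.Ioc (-π) π)) := by
  refine Integrable.const_mul ?_ _
  refine Integrable.mono' (integrable_const ((Real.exp |x|) ^ Fintype.card n)) ?_
    (Filter.Eventually.of_forall fun θ => ?_)
  · exact (continuous_finsetProd _ fun b _ => by fun_prop).aestronglyMeasurable
  · rw [norm_prod, ← Finset.card_univ, ← Finset.prod_const]
    refine Finset.prod_le_prod (fun b _ => norm_nonneg _) fun b _ => ?_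
    rw [norm_mul, show ((charVec σ b - charVec τ b : ℤ) : ℂ) * (θ b : ℂ) * I
        = (((charVec σ b - charVec τ b : ℤ) : ℝ) * θ b : ℝ) * I by push_cast; ring,
      Complex.norm_exp_ofReal_mul_I, mul_one, show (x : ℂ) * (Real.cos (θ b) : ℂ) = ((x * Real.cos (θ b) : ℝ) : ℂ) by
        push_cast; ring, Complex.norm_exp_ofReal, Real.exp_le_exp]
    calc x * Real.cos (θ b) ≤ |x * Real.cos (θ b)| := le_abs_self _
      _ = |x| * |Real.cos (θ b)| := abs_mul _ _
      _ ≤ |x| * 1 := mul_le_mul_of_nonneg_left (Real.abs_cos_le_one _) (abs_nonneg _)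
      _ = |x| := mul_one _

/-- **THE WEIGHTED VANDERMONDE INTEGRAL** (Andréief / Heine for the weight `e^{x cos θ}`):
`∫_{(−π,π]^N} (Π_b e^{x cos θ_b}) |Δ(e^{iθ})|² dθ = (2π)^N · N! · det[I_{|i−j|}(x)]_{i,j}` (entries indexed by
`n` through the fixed enumeration `enum n : n ≃ Fin N`). -/
theorem integral_cube_prod_cexp_cos_mul_norm_vdm_sq (x : ℝ) :
    ∫ θ, (∏ b, cexp ((x : ℂ) * Real.cos (θ b))) * ((‖vdm θ‖ ^ 2 : ℝ) : ℂ)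
        ∂(Measure.pi fun _ : n => (volume : Measure ℝ).restrict (Set.Ioc (-π) π))
      = (2 * π : ℂ) ^ Fintype.card n * (Fintype.card n).factorial *
          (Matrix.of fun i j : n => (besselI (((enum n i : ℕ) : ℤ) - ((enum n j : ℕ) : ℤ)).natAbs x : ℂ)).det := by
  -- expand `|Δ|²` and distribute the weight over the double Leibniz sum
  have hexp : ∀ θ : n → ℝ, (∏ b, cexp ((x : ℂ) * Real.cos (θ b))) * ((‖vdm θ‖ ^ 2 : ℝ) : ℂ)
      = ∑ σ : Perm n, ∑ τ : Perm n, ((Equiv.Perm.sign σ : ℤ) : ℂ) * ((Equiv.Perm.sign τ : ℤ) : ℂ) *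
          ∏ b, (cexp ((x : ℂ) * Real.cos (θ b)) * cexp ((charVec σ b - charVec τ b : ℤ) * θ b * I)) := by
    intro θ
    rw [norm_vdm_sq_eq_sum, Finset.mul_sum]
    refine Finset.sum_congr rfl fun σ _ => ?_
    rw [Finset.mul_sum]
    refine Finset.sum_congr rfl fun τ _ => ?_
    rw [Finset.prod_mul_distrib]
    ring
  simp_rw [hexp]
  rw [integral_finsetSum _ (fun σ _ => integrable_finsetSum _ fun τ _ => integrable_cube_weighted_term x σ τ)]
  simp_rw [integral_finsetSum _ (fun τ _ => integrable_cube_weighted_term x _ τ), integral_const_mul]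
  -- Fubini on the cube and the one-angle Fourier coefficients
  have hI : ∀ σ τ : Perm n,
      ∫ θ, ∏ b, (cexp ((x : ℂ) * Real.cos (θ b)) * cexp ((charVec σ b - charVec τ b : ℤ) * θ b * I))
        ∂(Measure.pi fun _ : n => (volume : Measure ℝ).restrict (Set.Ioc (-π) π))
      = (2 * π : ℂ) ^ Fintype.card n *
          ∏ b, (besselI (((enum n (σ.symm b) : ℕ) : ℤ) - ((enum n (τ.symm b) : ℕ) : ℤ)).natAbs x : ℂ) := by
    intro σ τ
    rw [integral_fintype_prod_eq_prod (𝕜 := ℂ)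
      (fun b (θ : ℝ) => cexp ((x : ℂ) * Real.cos θ) * cexp ((charVec σ b - charVec τ b : ℤ) * θ * I))]
    simp_rw [integral_Ioc_cexp_mul_cos_mul_cexp_int]
    rw [Finset.prod_mul_distrib, Finset.prod_const, Finset.card_univ]
    rfl
  simp_rw [hI]
  have hterm : ∀ σ τ : Perm n, ((Equiv.Perm.sign σ : ℤ) : ℂ) * ((Equiv.Perm.sign τ : ℤ) : ℂ) *
      ((2 * π : ℂ) ^ Fintype.card n *
        ∏ b, (besselI (((enum n (σ.symm b) : ℕ) : ℤ) - ((enum n (τ.symm b) : ℕ) : ℤ)).natAbs x : ℂ))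
      = (2 * π : ℂ) ^ Fintype.card n * (((Equiv.Perm.sign σ : ℤ) : ℂ) * ((Equiv.Perm.sign τ : ℤ) : ℂ) *
        ∏ b, (besselI (((enum n (σ.symm b) : ℕ) : ℤ) - ((enum n (τ.symm b) : ℕ) : ℤ)).natAbs x : ℂ)) := by
    intro σ τ; ring
  simp_rw [hterm, ← Finset.mul_sum]
  have key := sum_sum_sign_mul_sign_mul_prod_eq_factorial_mul_det
    (Matrix.of fun i j : n => (besselI (((enum n i : ℕ) : ℤ) - ((enum n j : ℕ) : ℤ)).natAbs x : ℂ))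
  simp only [Matrix.of_apply] at key
  rw [key, mul_assoc]

omit [DecidableEq n] in
/-- `Π_{j≺k}|e^{iθ_j} − e^{iθ_k}|² = |Δ(θ)|²` (the tree's `vdm`). -/
theorem prod_OD_norm_sub_sq_eq_norm_vdm_sq (θ : n → ℝ) :
    ∏ p : OD n, ‖cexp (θ p.1.1 * I) - cexp (θ p.1.2 * I)‖ ^ 2 = ‖vdm θ‖ ^ 2 := by
  rw [vdm, norm_prod, ← Finset.prod_pow]
  exact Finset.prod_congr rfl fun p _ => by rw [norm_sub_rev]

omit [DecidableEq n] in
/-- `|x Σ_b cos θ_b| ≤ |x| N`. -/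
theorem mul_sum_cos_le (x : ℝ) (θ : n → ℝ) : x * ∑ b, Real.cos (θ b) ≤ |x| * Fintype.card n :=
  calc x * ∑ b, Real.cos (θ b) ≤ |x * ∑ b, Real.cos (θ b)| := le_abs_self _
    _ = |x| * |∑ b, Real.cos (θ b)| := abs_mul _ _
    _ ≤ |x| * Fintype.card n := by
        refine mul_le_mul_of_nonneg_left ?_ (abs_nonneg _)
        calc |∑ b, Real.cos (θ b)| ≤ ∑ b, |Real.cos (θ b)| := Finset.abs_sum_le_sum_abs _ _
          _ ≤ ∑ _b : n, (1 : ℝ) := Finset.sum_le_sum fun b _ => Real.abs_cos_le_one _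
          _ = Fintype.card n := by simp

omit [DecidableEq n] in
/-- The real weighted Vandermonde integrand is integrable on the cube (continuous and bounded by
`e^{|x|N} 4^{#pairs}` on a set of finite measure). -/
theorem integrable_cube_exp_mul_sum_cos_mul_prod_norm_sub_sq (x : ℝ) :
    Integrable (fun θ : n → ℝ =>
      Real.exp (x * ∑ b, Real.cos (θ b)) * ∏ p : OD n, ‖cexp (θ p.1.1 * I) - cexp (θ p.1.2 * I)‖ ^ 2)
      (Measure.pi fun _ : n => (volume : Measure ℝ).restrict (Set.Ioc (-π) π)) := by
  simp_rw [prod_OD_norm_sub_sq_eq_norm_vdm_sq]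
  refine Integrable.mono' (integrable_const (Real.exp (|x| * Fintype.card n) * (2 ^ Fintype.card (OD n)) ^ 2))
    ((by fun_prop : Continuous fun θ : n → ℝ => Real.exp (x * ∑ b, Real.cos (θ b))).mul
      continuous_norm_vdm_sq).aestronglyMeasurable (Filter.Eventually.of_forall fun θ => ?_)
  rw [Real.norm_of_nonneg (mul_nonneg (Real.exp_nonneg _) (sq_nonneg _))]
  exact mul_le_mul (Real.exp_le_exp.2 (mul_sum_cos_le x θ)) (norm_vdm_sq_le θ) (sq_nonneg _) (Real.exp_nonneg _)

/-- The real form of §3: `∫_{(−π,π]^N} e^{x Σ_b cos θ_b} Π_{j≺k}|e^{iθ_j} − e^{iθ_k}|² dθ = (2π)^N N! det[I_{|i−j|}(x)]`. -/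
theorem integral_cube_exp_mul_sum_cos_mul_prod_norm_sub_sq (x : ℝ) :
    ∫ θ, Real.exp (x * ∑ b, Real.cos (θ b)) * ∏ p : OD n, ‖cexp (θ p.1.1 * I) - cexp (θ p.1.2 * I)‖ ^ 2
        ∂(Measure.pi fun _ : n => (volume : Measure ℝ).restrict (Set.Ioc (-π) π))
      = (2 * π) ^ Fintype.card n * (Fintype.card n).factorial *
          (Matrix.of fun i j : n => besselI (((enum n i : ℕ) : ℤ) - ((enum n j : ℕ) : ℤ)).natAbs x).det := by
  have hC := integral_cube_prod_cexp_cos_mul_norm_vdm_sq (n := n) x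
  have hcomm := Complex.ofRealCLM.integral_comp_comm (integrable_cube_exp_mul_sum_cos_mul_prod_norm_sub_sq (n := n) x)
  simp only [Complex.ofRealCLM_apply] at hcomm
  have hfun : ∀ θ : n → ℝ, (((Real.exp (x * ∑ b, Real.cos (θ b)) *
      ∏ p : OD n, ‖cexp (θ p.1.1 * I) - cexp (θ p.1.2 * I)‖ ^ 2 : ℝ)) : ℂ)
      = (∏ b, cexp ((x : ℂ) * Real.cos (θ b))) * ((‖vdm θ‖ ^ 2 : ℝ) : ℂ) := by
    intro θ
    rw [prod_OD_norm_sub_sq_eq_norm_vdm_sq, Complex.ofReal_mul, Finset.mul_sum, Real.exp_sum, Complex.ofReal_prod]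
    congr 1
    refine Finset.prod_congr rfl fun b _ => ?_
    rw [Complex.ofReal_exp]
    push_cast
    ring_nf
  simp_rw [hfun] at hcomm
  rw [hcomm] at hC
  have hdet : ((Matrix.of fun i j : n => besselI (((enum n i : ℕ) : ℤ) - ((enum n j : ℕ) : ℤ)).natAbs x).det : ℂ)
      = (Matrix.of fun i j : n => (besselI (((enum n i : ℕ) : ℤ) - ((enum n j : ℕ) : ℤ)).natAbs x : ℂ)).det := by
    rw [← Complex.ofRealHom_eq_coe, RingHom.map_det]
    congr 1
  rw [← hdet] at hC
  exact_mod_cast hC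

end Summit.Ventures.LatticeQCDFlow.Scoring
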